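import Literature.NumberTheory.Automorphic.FuchsianKloostermanSums
import HarnessLib

/-!
# The cusps `η∞` of `Γ₀(q)`: widths and scaling matrices (Iwaniec §2.4; Ngo 2024, Lemmas 2.3–2.4)

Topic `Literature/NumberTheory/Automorphic`, namespace `…Automorphic.Fuchsian`; continuation of
`FuchsianKloostermanSums.lean` §7 (which treats the two cusps `∞`, `0` of `Γ₀(q)`).  For an
arbitrary `η = (μ ∗; ν ∗) ∈ SL₂(ℤ)` the point `𝔞 = η∞ = μ/ν` is a cusp of `Γ₀(q)`, and
(T. Ngo, arXiv:2107.13301, Definition 2.2, Lemma 2.4 (1), after Motohashi; Iwaniec GSM 53 §2.4,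
p. 36 for `𝔞 = 1/v`, `(v, q/v) = 1`):

1. (§1) `η T^t η⁻¹ = (1 − tμν, tμ²; −tν², 1 + tμν)` lies in `Γ₀(q)` iff `q ∣ tν²` iff `w ∣ t`,
   with the **width** `w = cuspWidth q ν = q / (q, ν²)` (`conj_T_zpow_mem_Gamma0_iff`; Ngo's
   `width_{Γ₀(q)}(Γ₀(q)η) = q/gcd(q, ν²) = q''`);
2. (§2) the **scaling matrix** `σ_η = η · diag(√w, 1/√w) ∈ SL₂(ℝ)` (`sigmaEta`; Ngo's `η_𝔞 τ_𝔞`):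
   `σ_η ∞ = η∞` (`toGL_sigmaEta_smul_infty`), `T_x ∈ σ_η⁻¹ Γ₀(q) σ_η ↔ x ∈ ℤ`
   (`translSL_mem_cuspPairSet_sigmaEta_iff`), hence `(σ_η⁻¹ Γ₀(q) σ_η)` has periods exactly `ℤ` and
   contains `T_1` (`strictPeriods_conj_sigmaEta`, `upperRightHom_one_mem_conj_sigmaEta`) — i.e.
   `σ_η` is a scaling matrix of the cusp `η∞` in the sense of `FuchsianGroupCusps.exists_scaling`,
   so the Kloosterman sums `cuspKloosterman (Γ₀(q)) 1 σ_η` of `FuchsianKloostermanSums.lean` are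
   the `S_{σ_∞σ_𝔞}(m, n; c)` of Ngo's Definition 2.1 / Iwaniec's (2.23) for this cusp pair;
3. (§3) the elements of `σ_∞⁻¹ Γ₀(q) σ_η = Γ₀(q) σ_η` and their bottom rows
   `((cμ + dν)√w, (cμ' + dμ̃)/√w)` for `(a b; c d) ∈ Γ₀(q)`, `η = (μ μ'; ν μ̃)`
   (`mem_cuspPairSet_one_sigmaEta_iff`, `slCast_mul_sigmaEta_apply`) — the starting point of
   Ngo's Lemma 2.4 (2) (`𝒞_{∞𝔞} = √w · {νc : (c, q/ν) = 1}` for `ν ∣ q`) and of the explicit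
   evaluation of these Kloosterman sums (next bricks).

Everything is PROVED; no named facts.  Motivation: these are the cusp pairs `(∞, η∞)` of
`Γ₀(ad)` whose Kloosterman sums appear in Tóth's/Ngo's treatment of the roots of quadratic
congruences (`Literature/NumberTheory/Sieve/QuadraticRootsTothPitt.lean`, hypothesis `HK`).

## References

* T. Ngo, *On roots of quadratic congruences*, arXiv:2107.13301 (Bull. LMS 2024), §2.1
  Definitions 2.1–2.2, Lemmas 2.3–2.4. [cite: Ngo2024, §2.1 Definition 2.2, Lemma 2.4]
* H. Iwaniec, *Spectral Methods of Automorphic Forms*, GSM 53 (2002), §2.4 (the example `Γ₀(q)`,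
  cusps `1/v`), PDF pp. 35–36. [cite: Iwaniec2002, §2.4, PDF p. 36]
-/

noncomputable section

open Matrix
open scoped MatrixGroups Pointwise

namespace Literature.NumberTheory.Automorphic

namespace Fuchsian

/-! ## 1. The width of the cusp `η∞` of `Γ₀(q)` -/

section Width

variable (q : ℕ)

/-- **The width of the cusp `μ/ν` of `Γ₀(q)`**: `w = q / gcd(q, ν²)` (Ngo's `q'' = q/gcd(q, ν²)`).
[cite: Ngo2024, §2.1 Lemma 2.4 (1)] -/
def cuspWidth (ν : ℤ) : ℕ := q / Nat.gcd q (ν.natAbs ^ 2)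

/-- `w · gcd(q, ν²) = q`. [folklore] -/
theorem cuspWidth_mul_gcd (ν : ℤ) : cuspWidth q ν * Nat.gcd q (ν.natAbs ^ 2) = q :=
  Nat.div_mul_cancel (Nat.gcd_dvd_left _ _)

/-- `w ∣ q`. [folklore] -/
theorem cuspWidth_dvd (ν : ℤ) : cuspWidth q ν ∣ q :=
  Dvd.intro _ (cuspWidth_mul_gcd q ν)

variable [NeZero q]

/-- `w > 0`. [folklore] -/
theorem cuspWidth_pos (ν : ℤ) : 0 < cuspWidth q ν :=
  Nat.div_pos (Nat.le_of_dvd (Nat.pos_of_ne_zero (NeZero.ne q)) (Nat.gcd_dvd_left _ _))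
    (Nat.gcd_pos_of_pos_left _ (Nat.pos_of_ne_zero (NeZero.ne q)))

/-- **`q ∣ t ν² ↔ w ∣ t`** (`q = w·g`, `ν² = m·g` with `(w, m) = 1`, `g = gcd(q, ν²)`).
[cite: Ngo2024, §2.1 Lemma 2.4 (1)] -/
theorem dvd_mul_sq_iff (ν t : ℤ) : (q : ℤ) ∣ t * ν ^ 2 ↔ (cuspWidth q ν : ℤ) ∣ t := by
  set n : ℕ := ν.natAbs ^ 2 with hn
  set g : ℕ := Nat.gcd q n with hg
  have hq0 : 0 < q := Nat.pos_of_ne_zero (NeZero.ne q)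
  have hg0 : 0 < g := Nat.gcd_pos_of_pos_left _ hq0
  have hνn : (ν ^ 2 : ℤ) = (n : ℤ) := by rw [hn]; push_cast; exact (sq_abs ν).symm
  obtain ⟨m, hm⟩ : g ∣ n := Nat.gcd_dvd_right _ _
  have hqw : q = cuspWidth q ν * g := (cuspWidth_mul_gcd q ν).symm
  have hcop : Nat.Coprime (cuspWidth q ν) m := by
    have h1 : Nat.Coprime (q / g) (n / g) := Nat.coprime_div_gcd_div_gcd hg0
    have e1 : q / g = cuspWidth q ν := rfl
    have e2 : n / g = m := by rw [hm, Nat.mul_div_cancel_left _ hg0]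
    rwa [e1, e2] at h1
  have hgz : (g : ℤ) ≠ 0 := by exact_mod_cast hg0.ne'
  rw [hνn, hm]
  conv_lhs => rw [hqw]
  push_cast
  rw [show t * ((g : ℤ) * m) = (t * m) * g by ring, mul_dvd_mul_iff_right hgz]
  constructor
  · intro h
    exact (Int.isCoprime_iff_gcd_eq_one.2 (by exact_mod_cast hcop)).dvd_of_dvd_mul_right h
  · intro h
    exact h.mul_right _

/-- Entries of the conjugate `η T^t η⁻¹ = (1 − tμν, tμ²; −tν², 1 + tμν)` for
`η = (μ ∗; ν ∗) ∈ SL₂(ℤ)`. [cite: Ngo2024, §2.1 Definition 2.2] -/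
theorem conj_T_zpow_apply (η : SL(2, ℤ)) (t : ℤ) :
    (η * ModularGroup.T ^ t * η⁻¹) 1 0 = -(η 1 0) ^ 2 * t ∧
    (η * ModularGroup.T ^ t * η⁻¹) 0 1 = (η 0 0) ^ 2 * t ∧
    (η * ModularGroup.T ^ t * η⁻¹) 0 0 = 1 - η 0 0 * η 1 0 * t ∧
    (η * ModularGroup.T ^ t * η⁻¹) 1 1 = 1 + η 0 0 * η 1 0 * t := by
  have hdet : η 0 0 * η 1 1 - η 0 1 * η 1 0 = 1 := by
    have := η.det_coe; rwa [Matrix.det_fin_two] at this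
  have hT : ((ModularGroup.T ^ t : SL(2, ℤ)) : Matrix (Fin 2) (Fin 2) ℤ) = !![1, t; 0, 1] :=
    ModularGroup.coe_T_zpow t
  simp only [Matrix.SpecialLinearGroup.coe_mul, Matrix.SpecialLinearGroup.coe_inv, hT,
    Matrix.adjugate_fin_two, Matrix.mul_apply, Fin.sum_univ_two, Matrix.of_apply, Matrix.cons_val',
    Matrix.cons_val_zero, Matrix.cons_val_one, Matrix.empty_val', Matrix.cons_val_fin_one]
  refine ⟨by ring, by ring, by linear_combination hdet, by linear_combination hdet⟩

/-- **`η T^t η⁻¹ ∈ Γ₀(q) ↔ w ∣ t`**, `w = cuspWidth q ν`, `ν = η₁₀`: the width at infinity of the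
coset `Γ₀(q)η` is `q/gcd(q, ν²)`. [cite: Ngo2024, §2.1 Definition 2.2, Lemma 2.4 (1)] -/
theorem conj_T_zpow_mem_Gamma0_iff (η : SL(2, ℤ)) (t : ℤ) :
    η * ModularGroup.T ^ t * η⁻¹ ∈ CongruenceSubgroup.Gamma0 q ↔ (cuspWidth q (η 1 0) : ℤ) ∣ t := by
  rw [CongruenceSubgroup.Gamma0_mem, ZMod.intCast_zmod_eq_zero_iff_dvd, (conj_T_zpow_apply η t).1,
    show -(η 1 0) ^ 2 * t = -(t * (η 1 0) ^ 2) by ring, dvd_neg]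
  exact dvd_mul_sq_iff q (η 1 0) t

/-- `μ` and `ν` are coprime for `η = (μ ∗; ν ∗) ∈ SL₂(ℤ)`. [folklore] -/
theorem isCoprime_apply_00_10 (η : SL(2, ℤ)) : IsCoprime (η 0 0) (η 1 0) := by
  have hdet : η 0 0 * η 1 1 - η 0 1 * η 1 0 = 1 := by
    have := η.det_coe; rwa [Matrix.det_fin_two] at this
  exact ⟨η 1 1, -(η 0 1), by linear_combination hdet⟩

end Width

/-! ## 2. The scaling matrix `σ_η = η · diag(√w, 1/√w)` -/

section Scaling

variable (q : ℕ) [NeZero q]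

/-- `√w` as a unit of `ℝ`. [folklore] -/
def sqrtWidthUnit (ν : ℤ) : ℝˣ :=
  Units.mk0 (Real.sqrt (cuspWidth q ν)) (Real.sqrt_pos.2 (by exact_mod_cast cuspWidth_pos q ν)).ne'

/-- `(√w : ℝˣ) = √w`. [folklore] -/
@[simp] theorem val_sqrtWidthUnit (ν : ℤ) : (sqrtWidthUnit q ν : ℝ) = Real.sqrt (cuspWidth q ν) := rfl

/-- `(√w)² = w`. [folklore] -/
theorem sqrtWidthUnit_sq (ν : ℤ) : (sqrtWidthUnit q ν : ℝ) ^ 2 = (cuspWidth q ν : ℝ) := by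
  rw [val_sqrtWidthUnit, Real.sq_sqrt (Nat.cast_nonneg _)]

/-- **The scaling matrix of the cusp `η∞` of `Γ₀(q)`**: `σ_η = η · diag(√w, 1/√w)`,
`w = q/gcd(q, ν²)` (Ngo's `σ_𝔞 = η_𝔞 τ_𝔞`, `τ_𝔞 = diag(√q'', 1/√q'')`).
[cite: Ngo2024, §2.1 (before Lemma 2.4); Iwaniec2002, §2.4, PDF p. 36 (the case `𝔞 = 1/v`)] -/
def sigmaEta (η : SL(2, ℤ)) : SL(2, ℝ) := slCast η * diagSL2 (sqrtWidthUnit q (η 1 0))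

/-- Entry `(0,0)` of `diag(u, u⁻¹)`. [folklore] -/
@[simp] theorem diagSL2_apply_00 (u : ℝˣ) : diagSL2 u 0 0 = (u : ℝ) := rfl
/-- Entry `(0,1)` of `diag(u, u⁻¹)`. [folklore] -/
@[simp] theorem diagSL2_apply_01 (u : ℝˣ) : diagSL2 u 0 1 = 0 := rfl
/-- Entry `(1,0)` of `diag(u, u⁻¹)`. [folklore] -/
@[simp] theorem diagSL2_apply_10 (u : ℝˣ) : diagSL2 u 1 0 = 0 := rfl
/-- Entry `(1,1)` of `diag(u, u⁻¹)`. [folklore] -/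
@[simp] theorem diagSL2_apply_11 (u : ℝˣ) : diagSL2 u 1 1 = ((u⁻¹ : ℝˣ) : ℝ) := rfl

/-- **`diag(u, u⁻¹) T_x diag(u, u⁻¹)⁻¹ = T_{u² x}`.** [folklore] -/
theorem diagSL2_conj_translSL (u : ℝˣ) (x : ℝ) :
    diagSL2 u * translSL x * (diagSL2 u)⁻¹ = translSL ((u : ℝ) ^ 2 * x) := by
  have hu : (u : ℝ) * ((u⁻¹ : ℝˣ) : ℝ) = 1 := Units.mul_inv u
  have hu' : ((u⁻¹ : ℝˣ) : ℝ) * (u : ℝ) = 1 := Units.inv_mul u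
  rw [← map_inv]
  ext i j
  simp only [Matrix.SpecialLinearGroup.coe_mul, Matrix.mul_apply, Fin.sum_univ_two]
  fin_cases i <;> fin_cases j <;>
    simp only [Fin.zero_eta, Fin.isValue, Fin.mk_one, diagSL2_apply_00, diagSL2_apply_01,
      diagSL2_apply_10, diagSL2_apply_11, inv_inv, translSL_apply_00, translSL_apply_01,
      translSL_apply_10, translSL_apply_11, mul_one, mul_zero, zero_mul, add_zero, zero_add, hu, hu']
  linear_combination x * (u : ℝ) * hu - x * (u : ℝ) * hu

/-- **`σ_η T_x σ_η⁻¹ = η T_{wx} η⁻¹`** in `SL₂(ℝ)`. [folklore] -/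
theorem sigmaEta_conj_translSL (η : SL(2, ℤ)) (x : ℝ) :
    sigmaEta q η * translSL x * (sigmaEta q η)⁻¹ =
      slCast η * translSL ((cuspWidth q (η 1 0) : ℝ) * x) * (slCast η)⁻¹ := by
  unfold sigmaEta
  rw [_root_.mul_inv_rev, ← sqrtWidthUnit_sq q (η 1 0), ← diagSL2_conj_translSL]
  group

/-- `T^t ∈ SL₂(ℤ)` is cast to `T_t ∈ SL₂(ℝ)`. [folklore] -/
theorem slCast_T_zpow (t : ℤ) : slCast (ModularGroup.T ^ t) = translSL (t : ℝ) := by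
  have hT : ((ModularGroup.T ^ t : SL(2, ℤ)) : Matrix (Fin 2) (Fin 2) ℤ) = !![1, t; 0, 1] :=
    ModularGroup.coe_T_zpow t
  ext i j
  rw [slCast_apply, show (ModularGroup.T ^ t : SL(2, ℤ)) i j = (!![(1 : ℤ), t; 0, 1]) i j by
    rw [← hT]]
  fin_cases i <;> fin_cases j <;> simp

/-- `η T^t η⁻¹` is cast to `η T_t η⁻¹`. [folklore] -/
theorem slCast_conj_T_zpow (η : SL(2, ℤ)) (t : ℤ) :
    slCast (η * ModularGroup.T ^ t * η⁻¹) = slCast η * translSL (t : ℝ) * (slCast η)⁻¹ := by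
  rw [show slCast (η * ModularGroup.T ^ t * η⁻¹) =
      slCast η * slCast (ModularGroup.T ^ t) * slCast η⁻¹ from by simp only [slCast, map_mul],
    slCast_T_zpow, show slCast η⁻¹ = (slCast η)⁻¹ from map_inv _ η]

/-- **The periods of `σ_η⁻¹ Γ₀(q) σ_η` are the integers**: `T_x ∈ σ_η⁻¹ Γ₀(q) σ_η ↔ x ∈ ℤ`
(`σ_η T_x σ_η⁻¹ = η T_{wx} η⁻¹` is integral iff `wx ∈ ℤ`, by the coprimality of `μ², ν²`, and then
lies in `Γ₀(q)` iff `w ∣ wx`). [cite: Ngo2024, §2.1 Definition 2.2, Lemma 2.4 (1)] -/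
theorem translSL_mem_cuspPairSet_sigmaEta_iff (η : SL(2, ℤ)) (x : ℝ) :
    translSL x ∈ cuspPairSet (Gamma0GL q) (sigmaEta q η) (sigmaEta q η) ↔ ∃ n : ℤ, x = n := by
  rw [mem_cuspPairSet_iff, sigmaEta_conj_translSL, Subgroup.mem_map]
  set w : ℕ := cuspWidth q (η 1 0) with hw
  have hw0 : (w : ℝ) ≠ 0 := by exact_mod_cast (cuspWidth_pos q (η 1 0)).ne'
  constructor
  · rintro ⟨g, hg, hgeq⟩
    have hmat : slCast g = slCast η * translSL ((w : ℝ) * x) * (slCast η)⁻¹ :=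
      Matrix.SpecialLinearGroup.toGL_injective (by rw [← mapGL_eq_toGL_slCast]; exact hgeq)
    obtain ⟨h10, h01, -, -⟩ := conj_translSL_apply (slCast η) ((w : ℝ) * x)
    have e01 : ((g 0 1 : ℤ) : ℝ) = ((η 0 0 : ℤ) : ℝ) ^ 2 * ((w : ℝ) * x) := by
      have h : (slCast g : Matrix (Fin 2) (Fin 2) ℝ) 0 1 =
          ((slCast η * translSL ((w : ℝ) * x) * (slCast η)⁻¹ : SL(2, ℝ)) : Matrix (Fin 2) (Fin 2) ℝ) 0 1 := by
        rw [hmat]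
      rw [slCast_apply, h01] at h
      exact h
    have e10 : ((g 1 0 : ℤ) : ℝ) = -((η 1 0 : ℤ) : ℝ) ^ 2 * ((w : ℝ) * x) := by
      have h : (slCast g : Matrix (Fin 2) (Fin 2) ℝ) 1 0 =
          ((slCast η * translSL ((w : ℝ) * x) * (slCast η)⁻¹ : SL(2, ℝ)) : Matrix (Fin 2) (Fin 2) ℝ) 1 0 := by
        rw [hmat]
      rw [slCast_apply, h10] at h
      exact h
    obtain ⟨r, s, hrs⟩ := (isCoprime_apply_00_10 η).pow (m := 2) (n := 2)
    have hrs' : (r : ℝ) * ((η 0 0 : ℤ) : ℝ) ^ 2 + s * ((η 1 0 : ℤ) : ℝ) ^ 2 = 1 := by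
      exact_mod_cast hrs
    set t : ℤ := r * g 0 1 - s * g 1 0 with ht
    have hwx : (w : ℝ) * x = (t : ℝ) := by
      rw [ht]; push_cast; rw [e01, e10]
      linear_combination (-((w : ℝ) * x)) * hrs'
    have hg10 : g 1 0 = -(t * (η 1 0) ^ 2) := by
      have : ((g 1 0 : ℤ) : ℝ) = ((-(t * (η 1 0) ^ 2) : ℤ) : ℝ) := by
        push_cast; rw [e10, hwx]; ring
      exact_mod_cast this
    have hq : (q : ℤ) ∣ t * (η 1 0) ^ 2 := by
      have h1 : (q : ℤ) ∣ g 1 0 :=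
        (ZMod.intCast_zmod_eq_zero_iff_dvd _ _).1 ((CongruenceSubgroup.Gamma0_mem).1 hg)
      rwa [hg10, dvd_neg] at h1
    obtain ⟨n, hn⟩ := (dvd_mul_sq_iff q (η 1 0) t).1 hq
    refine ⟨n, mul_left_cancel₀ hw0 ?_⟩
    rw [hwx, hn]; push_cast; rfl
  · rintro ⟨n, rfl⟩
    refine ⟨η * ModularGroup.T ^ ((w : ℤ) * n) * η⁻¹,
      (conj_T_zpow_mem_Gamma0_iff q η _).2 (dvd_mul_right _ _), ?_⟩
    rw [mapGL_eq_toGL_slCast, slCast_conj_T_zpow]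
    push_cast
    rfl

/-- `T_1 ∈ σ_η⁻¹ Γ₀(q) σ_η`. [folklore] -/
theorem translSL_one_mem_cuspPairSet_sigmaEta (η : SL(2, ℤ)) :
    translSL 1 ∈ cuspPairSet (Gamma0GL q) (sigmaEta q η) (sigmaEta q η) :=
  (translSL_mem_cuspPairSet_sigmaEta_iff q η 1).2 ⟨1, by simp⟩

/-- **`σ_η` normalises the periods**: the periods of the conjugated group `σ_η⁻¹ Γ₀(q) σ_η` are
exactly `ℤ`. [cite: Ngo2024, §2.1 Lemma 2.4 (1); Iwaniec2002, §2.4 (2.1), PDF p. 36] -/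
theorem strictPeriods_conj_sigmaEta (η : SL(2, ℤ)) :
    (ConjAct.toConjAct (Matrix.SpecialLinearGroup.toGL (sigmaEta q η) : GL (Fin 2) ℝ)⁻¹ •
        Gamma0GL q).strictPeriods = AddSubgroup.zmultiples (1 : ℝ) := by
  ext x
  rw [Subgroup.mem_strictPeriods_iff, ← toGL_translSL, toGL_mem_conj_iff_mem_cuspPairSet,
    translSL_mem_cuspPairSet_sigmaEta_iff, AddSubgroup.mem_zmultiples_iff]
  constructor
  · rintro ⟨n, rfl⟩; exact ⟨n, by simp⟩
  · rintro ⟨n, hn⟩; exact ⟨n, by rw [← hn]; simp⟩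

/-- `T_1` lies in the conjugated group `σ_η⁻¹ Γ₀(q) σ_η`. [folklore] -/
theorem upperRightHom_one_mem_conj_sigmaEta (η : SL(2, ℤ)) :
    Matrix.GeneralLinearGroup.upperRightHom (1 : ℝ) ∈
      ConjAct.toConjAct (Matrix.SpecialLinearGroup.toGL (sigmaEta q η) : GL (Fin 2) ℝ)⁻¹ • Gamma0GL q := by
  rw [← toGL_translSL, toGL_mem_conj_iff_mem_cuspPairSet]
  exact translSL_one_mem_cuspPairSet_sigmaEta q η

/-- **`σ_η ∞ = η ∞`** (the diagonal factor fixes `∞`): `σ_η` is a scaling matrix of the cusp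
`𝔞 = η∞ = μ/ν` of `Γ₀(q)` in the sense of `FuchsianGroupCusps.exists_scaling`.
[cite: Ngo2024, §2.1 (before Lemma 2.4)] -/
theorem toGL_sigmaEta_smul_infty (η : SL(2, ℤ)) :
    (Matrix.SpecialLinearGroup.toGL (sigmaEta q η) : GL (Fin 2) ℝ) • (OnePoint.infty : OnePoint ℝ) =
      (Matrix.SpecialLinearGroup.mapGL ℝ η : GL (Fin 2) ℝ) • OnePoint.infty := by
  have hD : (Matrix.SpecialLinearGroup.toGL (diagSL2 (sqrtWidthUnit q (η 1 0))) : GL (Fin 2) ℝ) •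
      (OnePoint.infty : OnePoint ℝ) = OnePoint.infty :=
    OnePoint.smul_infty_eq_self_iff.2 rfl
  rw [sigmaEta, map_mul, mul_smul, hD, mapGL_eq_toGL_slCast]

/-- **`η∞` is a cusp of `Γ₀(q)`** (Mathlib's `IsCusp`): it is fixed by the parabolic element
`η T^w η⁻¹ ∈ Γ₀(q)`. [cite: Ngo2024, §2.1 Lemma 2.3] -/
theorem isCusp_mapGL_smul_infty (η : SL(2, ℤ)) :
    IsCusp ((Matrix.SpecialLinearGroup.mapGL ℝ η : GL (Fin 2) ℝ) • OnePoint.infty) (Gamma0GL q) := by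
  set w : ℕ := cuspWidth q (η 1 0) with hw
  have hw0 : (w : ℝ) ≠ 0 := by exact_mod_cast (cuspWidth_pos q (η 1 0)).ne'
  have hU : (Matrix.SpecialLinearGroup.mapGL ℝ (ModularGroup.T ^ (w : ℤ)) : GL (Fin 2) ℝ) =
      Matrix.GeneralLinearGroup.upperRightHom (w : ℝ) := by
    rw [mapGL_eq_toGL_slCast, slCast_T_zpow, toGL_translSL]; push_cast; rfl
  refine ⟨Matrix.SpecialLinearGroup.mapGL ℝ (η * ModularGroup.T ^ (w : ℤ) * η⁻¹),
    ⟨_, (conj_T_zpow_mem_Gamma0_iff q η _).2 dvd_rfl, rfl⟩, ?_, ?_⟩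
  · rw [map_mul, map_mul, map_inv, Matrix.GeneralLinearGroup.isParabolic_conj_iff, hU,
      Matrix.GeneralLinearGroup.isParabolic_iff_of_upperTriangular (by simp)]
    exact ⟨by simp, by simpa using hw0⟩
  · rw [map_mul, map_mul, map_inv, mul_smul, mul_smul, inv_smul_smul, hU,
      OnePoint.smul_infty_eq_self_iff.2 (by simp)]

end Scaling

/-! ## 3. The set `σ_∞⁻¹ Γ₀(q) σ_η = Γ₀(q) σ_η` and its rows -/

section Rows

variable (q : ℕ) [NeZero q]

/-- **`σ_∞⁻¹ Γ₀(q) σ_η = Γ₀(q) σ_η`**: membership in `cuspPairSet (Γ₀(q)) 1 σ_η`.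
[cite: Ngo2024, §2.1 Lemma 2.4 (2) (proof); Iwaniec2002, §2.4, PDF p. 36] -/
theorem mem_cuspPairSet_one_sigmaEta_iff (η : SL(2, ℤ)) {ω : SL(2, ℝ)} :
    ω ∈ cuspPairSet (Gamma0GL q) 1 (sigmaEta q η) ↔
      ∃ g : SL(2, ℤ), g ∈ CongruenceSubgroup.Gamma0 q ∧ slCast g * sigmaEta q η = ω := by
  rw [mem_cuspPairSet_iff, one_mul, Subgroup.mem_map]
  constructor
  · rintro ⟨g, hg, hgω⟩
    refine ⟨g, hg, ?_⟩
    have h1 : slCast g = ω * (sigmaEta q η)⁻¹ :=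
      Matrix.SpecialLinearGroup.toGL_injective (by rw [← mapGL_eq_toGL_slCast]; exact hgω)
    rw [h1, inv_mul_cancel_right]
  · rintro ⟨g, hg, rfl⟩
    refine ⟨g, hg, ?_⟩
    rw [mul_inv_cancel_right, mapGL_eq_toGL_slCast]

/-- Entries of a product in `SL₂(ℤ)`. [folklore] -/
theorem sl2z_mul_apply (g η : SL(2, ℤ)) (i j : Fin 2) :
    (g * η) i j = g i 0 * η 0 j + g i 1 * η 1 j := by
  simp [Matrix.mul_apply, Fin.sum_univ_two]

/-- **The entries of `g σ_η`** for `g = (a b; c d)`, `η = (μ μ'; ν μ̃)`: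
bottom row `((cμ + dν)√w, (cμ' + dμ̃)/√w)`, top row `((aμ + bν)√w, (aμ' + bμ̃)/√w)` — the moduli
and the `d`-entries of the Kloosterman sums `S_{σ_∞σ_𝔞}`. [cite: Ngo2024, §2.1 Lemma 2.4 (2), §3.5 Lemma 3.15 (proof)] -/
theorem slCast_mul_sigmaEta_apply (g η : SL(2, ℤ)) :
    (slCast g * sigmaEta q η) 1 0 =
        ((g 1 0 * η 0 0 + g 1 1 * η 1 0 : ℤ) : ℝ) * Real.sqrt (cuspWidth q (η 1 0)) ∧
    (slCast g * sigmaEta q η) 1 1 =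
        ((g 1 0 * η 0 1 + g 1 1 * η 1 1 : ℤ) : ℝ) * (Real.sqrt (cuspWidth q (η 1 0)))⁻¹ ∧
    (slCast g * sigmaEta q η) 0 0 =
        ((g 0 0 * η 0 0 + g 0 1 * η 1 0 : ℤ) : ℝ) * Real.sqrt (cuspWidth q (η 1 0)) ∧
    (slCast g * sigmaEta q η) 0 1 =
        ((g 0 0 * η 0 1 + g 0 1 * η 1 1 : ℤ) : ℝ) * (Real.sqrt (cuspWidth q (η 1 0)))⁻¹ := by
  unfold sigmaEta
  rw [← mul_assoc, show slCast g * slCast η = slCast (g * η) from (map_mul _ g η).symm]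
  have e : ∀ i j, slCast (g * η) i j = (((g * η : SL(2, ℤ)) i j : ℤ) : ℝ) := fun i j => slCast_apply _ i j
  have hinv : (((sqrtWidthUnit q (η 1 0))⁻¹ : ℝˣ) : ℝ) = (Real.sqrt (cuspWidth q (η 1 0)))⁻¹ := by
    rw [Units.val_inv_eq_inv_val, val_sqrtWidthUnit]
  simp only [Matrix.SpecialLinearGroup.coe_mul, Matrix.mul_apply, Fin.sum_univ_two, diagSL2_apply_00,
    diagSL2_apply_01, diagSL2_apply_10, diagSL2_apply_11, hinv, val_sqrtWidthUnit, e, sl2z_mul_apply,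
    mul_zero, add_zero, zero_add]
  refine ⟨?_, ?_, ?_, ?_⟩ <;> (push_cast; try ring)

/-- The moduli of the Kloosterman sums `S_{σ_∞σ_𝔞}` are the `(cμ + dν)√w`, `(c, d)` a bottom row
of `Γ₀(q)` (one inclusion of Ngo's Lemma 2.4 (2): `𝒞_{∞𝔞}(Γ₀(q)) ⊆ √w·(μℤq + νℤ)`).
[cite: Ngo2024, §2.1 Lemma 2.4 (2)] -/
theorem exists_of_mem_kloostermanModuli_sigmaEta {η : SL(2, ℤ)} {c : ℝ}
    (hc : c ∈ kloostermanModuli (Gamma0GL q) 1 (sigmaEta q η)) :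
    ∃ g : SL(2, ℤ), g ∈ CongruenceSubgroup.Gamma0 q ∧
      c = ((g 1 0 * η 0 0 + g 1 1 * η 1 0 : ℤ) : ℝ) * Real.sqrt (cuspWidth q (η 1 0)) := by
  obtain ⟨-, ω, hω, rfl⟩ := hc
  obtain ⟨g, hg, rfl⟩ := (mem_cuspPairSet_one_sigmaEta_iff q η).1 hω
  exact ⟨g, hg, (slCast_mul_sigmaEta_apply q g η).1⟩

end Rows

end Fuchsian

end Literature.NumberTheory.Automorphic
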